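import Literature.AlgebraicGeometry.Frobenioids.PerfectionRoots
import Literature.AlgebraicGeometry.Frobenioids.Prop55Sub
import Literature.AlgebraicGeometry.Frobenioids.ModelFrobenioidBirat
import HarnessLib

/-!
# Frobenioids I, Prop. 5.5 (iv), `C^pf` clause — the "root functors" from the model Frobenioid of
# `(Φ, B, Div_B)` to the model Frobenioid of the perfected data `(Φ^pf, B^pf, Div_B^pf)`

Mochizuki, *The geometry of Frobenioids I: the general theory*, Kyushu J. Math. **62** (2008)
293–400, §5, Proposition 5.5 (iv), kurims p. 104 ll. 40–43 [cite: MochizukiFrdI2008, Prop. 5.5 (iv) p.104]: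
"there is a natural equivalence of categories … between `C^pf` … and the model Frobenioid associated to
the data `Φ^pf, B^pf, B^pf → (Φ^gp)^pf`"; the perfection `C^pf` of Def. 3.1 (iii) p. 57 ("the pair
`(A, n)` is to be thought of as an '`n`-th root' of `A`").

The comparison is assembled (cell abc-iut, L1 sub-DAG row P55-L08, seat abc-iut-w5-d120) from the
following functors and arrows of the TARGET model Frobenioid `C' :=` the model Frobenioid of
`(Φ^pf, B^pf, Div_B^pf)` (abc-iut-L1-t5's perfected data `IsPerfectedDiv`):

* `rootFunctor N : C ⥤ C'`, `(A_D, α) ↦ (A_D, ι(α)^{1/N})`, `(d, f, Div, u) ↦ (d, f, ι(Div)^{1/N}, ι(u)^{1/N})`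
  — the morphism of model data `(ι_N, ι_N)` (`rootDataHom`; `rootFunctor 1` is the functor induced by
  `Φ → Φ^pf`, `B → B^pf`);
* `stdRoot A n a N : rootFunctor N A → rootFunctor n A` (`N = n a`), the standard Frobenius arrow
  `(a, id, 0, 0)` of `C'` — it is right-cancellable (`cancel_stdRoot`), natural in `A`
  (`stdRoot_naturality`) and transitive (`stdRoot_comp`);
* `rootLift φ` for an arrow `φ : A → Z` OF FROBENIUS TYPE in `C` (degree `a`, `N = n a`): the linear
  ISOMORPHISM `(1, Base φ, 0, ι(u_φ)^{1/N}) : rootFunctor n A ⥲ rootFunctor N Z` of `C'` — "in the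
  perfected model the `a`-th Frobenius arrow `A → A^{(a)}` becomes, after extracting `N`-th roots, an
  isomorphism onto the image of the root `A^{(a)}`" — characterised by
  `stdRoot ≫ rootLift φ = rootFunctor N φ` (`stdRoot_rootLift`), and multiplicative in `φ` (`rootLift_comp`).

Hypotheses: `B` group-like and `Φ` integral objectwise (so that `N`-th roots are unique in `(Φ^pf)^gp`,
whence `Div_B^pf` commutes with roots, `divB_root`). No statement of the paper is strengthened; nothing
here bears on [IUTchIII] or asserts anything about abc.
-/

noncomputable section

namespace Literature.AlgebraicGeometry.Frobenioids

open CategoryTheory Opposite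

universe w v u

namespace ModelFrobenioid

variable {D : Type u} [Category.{v} D] {Φ B : Dᵒᵖ ⥤ CommMonCat.{w}} {DivB : B ⟶ monoidGp Φ}
  {DivBpf : perfectionFunctor B ⟶ monoidGp (perfectionFunctor Φ)}

/-! ### `Div_B^pf` versus roots and versus `Div_B` -/

/-- `Div_B^pf` extends `Div_B`: `Div_B^pf(ι u) = ι^gp(Div_B u)` (the compatibility `IsPerfectedDiv`,
componentwise). [cite: MochizukiFrdI2008, Prop. 5.5 (iv) p.104] -/
theorem divB_toPerfectionFunctor (hpf : IsPerfectedDiv Φ B DivB DivBpf) (A : Dᵒᵖ) (u : B.obj A) :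
    divB (perfectionFunctor Φ) (perfectionFunctor B) DivBpf A (((toPerfectionFunctor B).app A).hom u) =
      gpApp (toPerfectionFunctor Φ) A (divB Φ B DivB A u) := by
  have h := congrArg (fun η => (CommMonCat.Hom.hom (NatTrans.app η A)) u) hpf
  exact h

/-- `Div_B^pf` commutes with `N`-th roots (`Φ` integral: roots are unique in `(Φ^pf)^gp`).
[cite: MochizukiFrdI2008, Prop. 5.5 (iv) p.104] -/
theorem divB_root (hΦc : ∀ A : Dᵒᵖ, IsCancelMul (Φ.obj A)) (N : ℕ+) (A : Dᵒᵖ)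
    (v : (perfectionFunctor B).obj A) :
    divB (perfectionFunctor Φ) (perfectionFunctor B) DivBpf A (Perfection.root N v) =
      MonGp.map (Perfection.root N) (divB (perfectionFunctor Φ) (perfectionFunctor B) DivBpf A v) := by
  haveI := hΦc A
  exact (Perfection.gpRoot_map_eq N (divB (perfectionFunctor Φ) (perfectionFunctor B) DivBpf A)
    (Perfection.root_pow N v)).symm

/-- `ι_N^gp(Div_B u) = Div_B^pf(ι_N u)`: the maps `a ↦ a^{1/N}` form a morphism of model data
`(Φ, B, Div_B) → (Φ^pf, B^pf, Div_B^pf)`. [cite: MochizukiFrdI2008, Prop. 5.5 (iv) p.104] -/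
theorem gpApp_toPerfectionRoot_divB (hΦc : ∀ A : Dᵒᵖ, IsCancelMul (Φ.obj A))
    (hpf : IsPerfectedDiv Φ B DivB DivBpf) (N : ℕ+) (A : Dᵒᵖ) (u : B.obj A) :
    gpApp (toPerfectionRoot Φ N) A (divB Φ B DivB A u) =
      divB (perfectionFunctor Φ) (perfectionFunctor B) DivBpf A (((toPerfectionRoot B N).app A).hom u) := by
  rw [gpApp_toPerfectionRoot_eq, toPerfectionRoot_app_apply, ← toPerfectionFunctor_app_apply (Φ := B),
    divB_root hΦc, divB_toPerfectionFunctor hpf]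

/-! ### The root functors `C → C'` -/

section Root

variable (hΦc : ∀ A : Dᵒᵖ, IsCancelMul (Φ.obj A)) (hpf : IsPerfectedDiv Φ B DivB DivBpf)

/-- The morphism of model data `(ι_N, ι_N) : (Φ, B, Div_B) → (Φ^pf, B^pf, Div_B^pf)`, `a ↦ a^{1/N}`.
[cite: MochizukiFrdI2008, Prop. 5.5 (iv) p.104] -/
def rootDataHom (N : ℕ+) : DataHom DivB DivBpf where
  η := toPerfectionRoot Φ N
  β := toPerfectionRoot B N
  comm A u := gpApp_toPerfectionRoot_divB hΦc hpf N A u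

/-- **The root functor `rootFunctor N : C → C'`**, `(A_D, α) ↦ (A_D, ι(α)^{1/N})`,
`(d, f, Div, u) ↦ (d, f, ι(Div)^{1/N}, ι(u)^{1/N})`. [cite: MochizukiFrdI2008, Prop. 5.5 (iv) p.104] -/
def rootFunctor (N : ℕ+) :
    ModelFrobenioid Φ B DivB ⥤ ModelFrobenioid (perfectionFunctor Φ) (perfectionFunctor B) DivBpf :=
  (rootDataHom hΦc hpf N).functor

variable {hΦc hpf}

variable (DivBpf) in
/-- The object `(A_D, ι(α)^{1/N})` of `C'` — the value of `rootFunctor N` on `(A_D, α)`, as a term whose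
base is SYNTACTICALLY `A_D`. [cite: MochizukiFrdI2008, Prop. 5.5 (iv) p.104] -/
abbrev rootObj (N : ℕ+) (X : ModelFrobenioid Φ B DivB) :
    ModelFrobenioid (perfectionFunctor Φ) (perfectionFunctor B) DivBpf :=
  ⟨X.base, gpApp (toPerfectionRoot Φ N) (op X.base) X.cls⟩

/-- `rootFunctor N` on objects is `rootObj N`. [cite: MochizukiFrdI2008, Prop. 5.5 (iv) p.104] -/
theorem rootFunctor_obj (N : ℕ+) (X : ModelFrobenioid Φ B DivB) :
    (rootFunctor hΦc hpf N).obj X = rootObj DivBpf N X := rfl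

variable (hΦc hpf) in
/-- `rootFunctor N` on arrows, between the objects `rootObj`. [cite: MochizukiFrdI2008, Prop. 5.5 (iv) p.104] -/
abbrev rootMap (N : ℕ+) {X Y : ModelFrobenioid Φ B DivB} (φ : X ⟶ Y) :
    rootObj DivBpf N X ⟶ rootObj DivBpf N Y :=
  (rootFunctor hΦc hpf N).map φ

/-- `rootMap` is functorial: identities. [cite: MochizukiFrdI2008, Prop. 5.5 (iv) p.104] -/
theorem rootMap_id (N : ℕ+) (X : ModelFrobenioid Φ B DivB) :
    rootMap hΦc hpf N (𝟙 X) = 𝟙 (rootObj DivBpf N X) :=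
  (rootFunctor hΦc hpf N).map_id X

/-- `rootMap` is functorial: composites. [cite: MochizukiFrdI2008, Prop. 5.5 (iv) p.104] -/
theorem rootMap_comp (N : ℕ+) {X Y Z : ModelFrobenioid Φ B DivB} (φ : X ⟶ Y) (ψ : Y ⟶ Z) :
    rootMap hΦc hpf N (φ ≫ ψ) = rootMap hΦc hpf N φ ≫ rootMap hΦc hpf N ψ :=
  (rootFunctor hΦc hpf N).map_comp φ ψ

/-- `rootMap` on arrows: Frobenius degree. [cite: MochizukiFrdI2008, Prop. 5.5 (iv) p.104] -/
@[simp] theorem degFr_rootMap (N : ℕ+) {X Y : ModelFrobenioid Φ B DivB} (φ : X ⟶ Y) :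
    degFr (rootMap hΦc hpf N φ) = degFr φ := rfl

/-- `rootMap` on arrows: base. [cite: MochizukiFrdI2008, Prop. 5.5 (iv) p.104] -/
@[simp] theorem baseMap_rootMap (N : ℕ+) {X Y : ModelFrobenioid Φ B DivB} (φ : X ⟶ Y) :
    baseMap (rootMap hΦc hpf N φ) = baseMap φ := rfl

/-- `rootMap` on arrows: zero divisor `ι(Div)^{1/N}`. [cite: MochizukiFrdI2008, Prop. 5.5 (iv) p.104] -/
@[simp] theorem div_rootMap (N : ℕ+) {X Y : ModelFrobenioid Φ B DivB} (φ : X ⟶ Y) :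
    div (rootMap hΦc hpf N φ) = Perfection.root N (Perfection.of _ (div φ)) := rfl

/-- `rootMap` on arrows: unit `ι(u)^{1/N}`. [cite: MochizukiFrdI2008, Prop. 5.5 (iv) p.104] -/
@[simp] theorem unit_rootMap (N : ℕ+) {X Y : ModelFrobenioid Φ B DivB} (φ : X ⟶ Y) :
    unit (rootMap hΦc hpf N φ) = Perfection.root N (Perfection.of _ (unit φ)) := rfl

/-! ### The standard Frobenius arrows `rootFunctor N A → rootFunctor n A` of `C'` -/

variable (DivBpf) in
/-- The standard Frobenius arrow `(a, id, 0, 0) : (A_D, ι(α)^{1/N}) → (A_D, ι(α)^{1/n})` of `C'` for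
`N = n a`. [cite: MochizukiFrdI2008, Def. 3.1 (iii) p.57] -/
def stdRoot (X : ModelFrobenioid Φ B DivB) (n a N : ℕ+) (h : n * a = N) :
    rootObj DivBpf N X ⟶ rootObj DivBpf n X :=
  mkHom _ _ a (𝟙 X.base) 1 1 (by
    subst h
    rw [map_one, mul_one, map_one, mul_one]
    exact (gpApp_toPerfectionRoot_mul_pow n a (op X.base) X.cls).trans
      (pullGp_id (Φ := perfectionFunctor Φ) X.base _).symm)

/-- Components of `stdRoot`. [cite: MochizukiFrdI2008, Def. 3.1 (iii) p.57] -/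
@[simp] theorem degFr_stdRoot (X : ModelFrobenioid Φ B DivB) (n a N : ℕ+) (h : n * a = N) :
    degFr (stdRoot DivBpf X n a N h) = a := rfl

/-- Components of `stdRoot`. [cite: MochizukiFrdI2008, Def. 3.1 (iii) p.57] -/
@[simp] theorem baseMap_stdRoot (X : ModelFrobenioid Φ B DivB) (n a N : ℕ+) (h : n * a = N) :
    baseMap (stdRoot DivBpf X n a N h) = 𝟙 X.base := rfl

/-- Components of `stdRoot`. [cite: MochizukiFrdI2008, Def. 3.1 (iii) p.57] -/
@[simp] theorem div_stdRoot (X : ModelFrobenioid Φ B DivB) (n a N : ℕ+) (h : n * a = N) :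
    div (stdRoot DivBpf X n a N h) = 1 := rfl

/-- Components of `stdRoot`. [cite: MochizukiFrdI2008, Def. 3.1 (iii) p.57] -/
@[simp] theorem unit_stdRoot (X : ModelFrobenioid Φ B DivB) (n a N : ℕ+) (h : n * a = N) :
    unit (stdRoot DivBpf X n a N h) = 1 := rfl

/-- **The standard Frobenius arrow is right-cancellable** (an epimorphism of `C'`).
[cite: MochizukiFrdI2008, Def. 3.1 (iii) p.57] -/
theorem cancel_stdRoot (X : ModelFrobenioid Φ B DivB) (n a N : ℕ+) (h : n * a = N)
    {W : ModelFrobenioid (perfectionFunctor Φ) (perfectionFunctor B) DivBpf}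
    {x y : rootObj DivBpf n X ⟶ W}
    (hxy : stdRoot DivBpf X n a N h ≫ x = stdRoot DivBpf X n a N h ≫ y) : x = y := by
  have hd := congrArg degFr hxy
  have hb := congrArg baseMap hxy
  have hv := congrArg div hxy
  have hu := congrArg unit hxy
  simp only [degFr_comp, degFr_stdRoot] at hd
  simp only [baseMap_comp, baseMap_stdRoot, Category.id_comp] at hb
  simp only [div_comp, div_stdRoot, one_pow, mul_one, baseMap_stdRoot, op_id, CategoryTheory.Functor.map_id,
    CommMonCat.hom_id, MonoidHom.id_apply] at hv
  simp only [unit_comp, unit_stdRoot, one_pow, mul_one, baseMap_stdRoot, op_id, CategoryTheory.Functor.map_id,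
    CommMonCat.hom_id, MonoidHom.id_apply] at hu
  exact hom_ext (mul_right_cancel hd) hb hv hu

/-- **Naturality of the standard Frobenius arrows**: `rootFunctor N φ ≫ stdRoot = stdRoot ≫ rootFunctor n φ`.
[cite: MochizukiFrdI2008, Prop. 1.10 (i) p.34] -/
theorem stdRoot_naturality {X Y : ModelFrobenioid Φ B DivB} (φ : X ⟶ Y) (n a N : ℕ+) (h : n * a = N) :
    rootMap hΦc hpf N φ ≫ stdRoot DivBpf Y n a N h = stdRoot DivBpf X n a N h ≫ rootMap hΦc hpf n φ := by
  subst h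
  refine hom_ext ?_ ?_ ?_ ?_
  · simp only [degFr_comp, degFr_stdRoot, degFr_rootMap, mul_comm]
  · simp only [baseMap_comp, baseMap_stdRoot, baseMap_rootMap, Category.comp_id, Category.id_comp]
  · simp only [div_comp, div_stdRoot, degFr_stdRoot, map_one, one_mul, div_rootMap, baseMap_stdRoot, op_id,
      CategoryTheory.Functor.map_id, CommMonCat.hom_id, MonoidHom.id_apply, one_pow, mul_one]
    exact Perfection.root_mul_pow n a _
  · simp only [unit_comp, unit_stdRoot, degFr_stdRoot, map_one, one_mul, unit_rootMap, baseMap_stdRoot, op_id,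
      CategoryTheory.Functor.map_id, CommMonCat.hom_id, MonoidHom.id_apply, one_pow, mul_one]
    exact Perfection.root_mul_pow n a _

/-- **Transitivity of the standard Frobenius arrows**: `stdRoot (N' → N) ≫ stdRoot (N → n) = stdRoot (N' → n)`.
[cite: MochizukiFrdI2008, Def. 3.1 (iii) p.57] -/
theorem stdRoot_comp (X : ModelFrobenioid Φ B DivB) (n a N t N' a' : ℕ+) (h : n * a = N) (h' : N * t = N')
    (hat : a * t = a') (h'' : n * a' = N') :
    stdRoot DivBpf X N t N' h' ≫ stdRoot DivBpf X n a N h = stdRoot DivBpf X n a' N' h'' := by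
  subst hat
  refine hom_ext ?_ ?_ ?_ ?_
  · simp only [degFr_comp, degFr_stdRoot]
  · simp only [baseMap_comp, baseMap_stdRoot, Category.comp_id]
  · simp only [div_comp, div_stdRoot, map_one, one_pow, mul_one]
  · simp only [unit_comp, unit_stdRoot, map_one, one_pow, mul_one]

/-! ### The isomorphisms `rootLift φ` attached to arrows of Frobenius type -/

/-- Relation (d) of an arrow of Frobenius type `φ = (a, g, 0, u)` of `C`: `α^a = Φ(g)(ζ) + Div_B(u)`.
[cite: MochizukiFrdI2008, Thm. 5.2 (i) p.100] -/
theorem rel_of_isFrobeniusType {A Z : ModelFrobenioid Φ B DivB} (φ : A ⟶ Z)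
    (hφ : PreFrobenioid.IsFrobeniusType (toElem Φ B DivB) φ) :
    A.cls ^ (degFr φ : ℕ) = pullGp Φ (baseMap φ) Z.cls * divB Φ B DivB (op A.base) (unit φ) := by
  have hd : div φ = 1 := hφ.1.2
  have h := rel φ
  rwa [hd, map_one, mul_one] at h

variable (hΦc hpf) in
/-- **`rootLift φ : rootFunctor n A → rootFunctor N Z`** for an arrow `φ : A → Z` of Frobenius type of
degree `a` in `C` and `N = n a`: the linear arrow `(1, Base φ, 0, ι(u_φ)^{1/N})` of `C'`.
[cite: MochizukiFrdI2008, Prop. 5.5 (iv) p.104] -/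
def rootLift {A Z : ModelFrobenioid Φ B DivB} (φ : A ⟶ Z) (hφ : PreFrobenioid.IsFrobeniusType (toElem Φ B DivB) φ)
    (n a N : ℕ+) (ha : degFr φ = a) (h : n * a = N) :
    rootObj DivBpf n A ⟶ rootObj DivBpf N Z :=
  mkHom (rootObj DivBpf n A) (rootObj DivBpf N Z) 1 (baseMap (X := A) (Y := Z) φ) 1
    (Perfection.root N (Perfection.of (B.obj (op A.base)) (unit (X := A) (Y := Z) φ))) (by
    subst h ha
    have hr := congrArg (gpApp (toPerfectionRoot Φ (n * degFr φ)) (op A.base)) (rel_of_isFrobeniusType φ hφ)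
    rw [map_pow, gpApp_toPerfectionRoot_mul_pow, map_mul, gpApp_pullGp, gpApp_toPerfectionRoot_divB hΦc hpf] at hr
    rw [PNat.one_coe, pow_one, map_one, mul_one]
    exact hr)

/-- Components of `rootLift`. [cite: MochizukiFrdI2008, Prop. 5.5 (iv) p.104] -/
@[simp] theorem degFr_rootLift {A Z : ModelFrobenioid Φ B DivB} (φ : A ⟶ Z)
    (hφ : PreFrobenioid.IsFrobeniusType (toElem Φ B DivB) φ) (n a N : ℕ+) (ha : degFr φ = a) (h : n * a = N) :
    degFr (rootLift hΦc hpf φ hφ n a N ha h) = 1 := rfl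

/-- Components of `rootLift`. [cite: MochizukiFrdI2008, Prop. 5.5 (iv) p.104] -/
@[simp] theorem baseMap_rootLift {A Z : ModelFrobenioid Φ B DivB} (φ : A ⟶ Z)
    (hφ : PreFrobenioid.IsFrobeniusType (toElem Φ B DivB) φ) (n a N : ℕ+) (ha : degFr φ = a) (h : n * a = N) :
    baseMap (rootLift hΦc hpf φ hφ n a N ha h) = baseMap φ := rfl

/-- Components of `rootLift`. [cite: MochizukiFrdI2008, Prop. 5.5 (iv) p.104] -/
@[simp] theorem div_rootLift {A Z : ModelFrobenioid Φ B DivB} (φ : A ⟶ Z)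
    (hφ : PreFrobenioid.IsFrobeniusType (toElem Φ B DivB) φ) (n a N : ℕ+) (ha : degFr φ = a) (h : n * a = N) :
    div (rootLift hΦc hpf φ hφ n a N ha h) = 1 := rfl

/-- Components of `rootLift`. [cite: MochizukiFrdI2008, Prop. 5.5 (iv) p.104] -/
@[simp] theorem unit_rootLift {A Z : ModelFrobenioid Φ B DivB} (φ : A ⟶ Z)
    (hφ : PreFrobenioid.IsFrobeniusType (toElem Φ B DivB) φ) (n a N : ℕ+) (ha : degFr φ = a) (h : n * a = N) :
    unit (rootLift hΦc hpf φ hφ n a N ha h) = Perfection.root N (Perfection.of _ (unit φ)) := rfl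

/-- `rootLift` does not depend on the proofs/labels: congruence in `φ`. [cite: MochizukiFrdI2008, Prop. 5.5 (iv) p.104] -/
theorem rootLift_congr {A Z : ModelFrobenioid Φ B DivB} {φ φ' : A ⟶ Z} (e : φ = φ')
    (hφ : PreFrobenioid.IsFrobeniusType (toElem Φ B DivB) φ) (hφ' : PreFrobenioid.IsFrobeniusType (toElem Φ B DivB) φ')
    (n a N : ℕ+) (ha : degFr φ = a) (ha' : degFr φ' = a) (h : n * a = N) :
    rootLift hΦc hpf φ hφ n a N ha h = rootLift hΦc hpf φ' hφ' n a N ha' h := by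
  subst e
  rfl

/-- **Characterisation of `rootLift`**: `stdRoot ≫ rootLift φ = rootFunctor N φ` — "the `a`-th
Frobenius arrow of `C` is, in `C'` after extracting `N`-th roots, the standard Frobenius arrow followed by
an isomorphism". [cite: MochizukiFrdI2008, Prop. 5.5 (iv) p.104] -/
theorem stdRoot_rootLift {A Z : ModelFrobenioid Φ B DivB} (φ : A ⟶ Z)
    (hφ : PreFrobenioid.IsFrobeniusType (toElem Φ B DivB) φ) (n a N : ℕ+) (ha : degFr φ = a) (h : n * a = N) :
    stdRoot DivBpf A n a N h ≫ rootLift hΦc hpf φ hφ n a N ha h = rootMap hΦc hpf N φ := by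
  have hd : div φ = 1 := hφ.1.2
  refine hom_ext ?_ ?_ ?_ ?_
  · simp only [degFr_comp, degFr_stdRoot, degFr_rootLift, one_mul, degFr_rootMap, ha]
  · simp only [baseMap_comp, baseMap_stdRoot, baseMap_rootLift, Category.id_comp, baseMap_rootMap]
  · simp only [div_comp, div_rootLift, map_one, div_stdRoot, one_pow, mul_one, div_rootMap, hd]
    rfl
  · simp only [unit_comp, unit_rootLift, unit_stdRoot, degFr_rootLift, PNat.one_coe, pow_one, mul_one,
      unit_rootMap, baseMap_stdRoot, op_id, CategoryTheory.Functor.map_id, CommMonCat.hom_id,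
      MonoidHom.id_apply]

/-- `rootLift φ` is an isomorphism of `C'` (linear, base-isomorphic, isometric; `B^pf` group-like).
[cite: MochizukiFrdI2008, Prop. 5.5 (iv) p.104] -/
theorem isIso_rootLift (hB : ∀ (A : Dᵒᵖ) (b : B.obj A), IsUnit b) {A Z : ModelFrobenioid Φ B DivB} (φ : A ⟶ Z)
    (hφ : PreFrobenioid.IsFrobeniusType (toElem Φ B DivB) φ) (n a N : ℕ+) (ha : degFr φ = a) (h : n * a = N) :
    IsIso (rootLift hΦc hpf φ hφ n a N ha h) := by
  have hBpf : Objectwise (fun M _ => IsGroupLike M) (perfectionFunctor B) := fun X =>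
    isGroupLike_of_forall_isUnit (Perfection.isUnit_of_forall_isUnit (hB (op X)))
  haveI : IsIso (baseMap (rootLift hΦc hpf φ hφ n a N ha h)) := hφ.2
  exact isIso_of hBpf _ rfl rfl

/-- **`rootLift` is multiplicative**: for composable arrows of Frobenius type `φ : A → Z` (degree `a`) and
`τ : Z → W` (degree `t`), `rootLift (φ ≫ τ) = rootLift φ ≫ rootLift τ` (levels `n → n a → n a t`).
[cite: MochizukiFrdI2008, Prop. 5.5 (iv) p.104] -/
theorem rootLift_comp {A Z W : ModelFrobenioid Φ B DivB} (φ : A ⟶ Z) (τ : Z ⟶ W)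
    (hφ : PreFrobenioid.IsFrobeniusType (toElem Φ B DivB) φ) (hτ : PreFrobenioid.IsFrobeniusType (toElem Φ B DivB) τ)
    (hφτ : PreFrobenioid.IsFrobeniusType (toElem Φ B DivB) (φ ≫ τ))
    (n a N t N' a' : ℕ+) (ha : degFr φ = a) (ht : degFr τ = t) (haa : a * t = a') (hat : degFr (φ ≫ τ) = a')
    (h : n * a = N) (h' : N * t = N') (h'' : n * a' = N') :
    rootLift hΦc hpf (φ ≫ τ) hφτ n a' N' hat h'' =
      rootLift hΦc hpf φ hφ n a N ha h ≫ rootLift hΦc hpf τ hτ N t N' ht h' := by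
  subst haa h h'
  refine hom_ext ?_ ?_ ?_ ?_
  · simp only [degFr_comp, degFr_rootLift, mul_one]
  · rfl
  · simp only [div_comp, div_rootLift, map_one, one_pow, mul_one]
  · simp only [unit_comp, unit_rootLift, baseMap_rootLift, degFr_rootLift, ht, PNat.one_coe, pow_one, map_mul,
      map_pow]
    congr 1
    exact Perfection.root_mul_pow (n * a) t _

end Root

end ModelFrobenioid

end Literature.AlgebraicGeometry.Frobenioids

end
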